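import Summits.HodgeConjecture.HodgeConjecture.Theorems.WeilTypeLadderTargetTransfer
import Literature.AlgebraicGeometry.HodgeTheory.FermatHodgeConjectureProducts
import Mathlib.RingTheory.Polynomial.Cyclotomic.Roots
import Mathlib.RingTheory.Polynomial.Eisenstein.Basic
import Mathlib.Analysis.SpecialFunctions.Complex.Circle
import Mathlib.Tactic.ComputeDegree
import HarnessLib

/-!
# WeilTypeLadder · R3 (`WeilClassesCMField`) for the QUARTIC CM subfield `K′ = ℚ(ζ₁₃)^{C₃}` of `ℚ(ζ₁₃)` (`[E:K′] = 3`): minimal polynomial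
# `T⁴ + 13T² + 13` of `θ = η − η̄` (`η = ζ + ζ³ + ζ⁹` a Gaussian period), the rung's eight arithmetic hypotheses DISCHARGED (Eisenstein
# at `13`, purely imaginary roots, `Q = −T`, `P(φ) = 0 ⇐ Φ₁₃(s) = 0`), the transfer over a Fermat TRIPLE `(Xʰ₁₃ ⊗ Xʰ₁₃) ⊗ Xʰ₁₃`

b2b cell `hweil` (packet `run/shared/lean/b2b/hodge-weil/`, report `b2b-hweil-pv3-g43/CM-SUBFIELD-TRANSFER.md` §3.3 row `(13, C₃)`
and ADDENDUM A). Companion of `Theorems/WeilTypeLadderCyclicPrymQuarticCMField` / `…CyclicPrymSixteenCyclicQuartic` (the `s = 2` rows).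
Here `E = ℚ(ζ₁₃)`, `U = (ℤ/13)ˣ ≅ ℤ/12`, `H′ = C₃ = {1, 3, 9}`, `K′ = E^{H′}` the cyclic QUARTIC CM subfield (`K′⁺ = ℚ(√13)`), `s = |H′| = 3`:
PROPOSITION CYC′ transfers the `K′`-Weil classes to the TRIPLE product `(Xʰ₁₃)³` (Shioda's Thm. 2 with three factors,
`hodgeClasses_algebraic_fermatProduct₃`, `13` prime). Generator: the Gaussian period `η = ζ + ζ³ + ζ⁹` has `η̄ = ζ⁴ + ζ¹⁰ + ζ¹²`, and
`θ := η − η̄` generates `K′` with `θ̄ = −θ`; its minimal polynomial is **`P = T⁴ + 13T² + 13`** (Eisenstein at `13`); on `B` with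
`Φ₁₃(s) = 0` the field acts through **`φ := s + s³ + s⁹ − s⁴ − s¹⁰ − s¹²`**, and `P(φ) = 0` because
`P(T + T³ + T⁹ − T⁴ − T¹⁰ − T¹²) = Φ₁₃(T)·q(T)` in `ℤ[T]` for an explicit `q` of degree `36` (§1). Dimensions: `dim B = 6h` with `h = 2n`
EVEN (`hs/2 = 3n`), `K′`-Weil classes `weilClassesField B φ P (6n) ⊂ H^{6n}(B)`, `e·(2m) = 4·6n = 2·dim B`.

What is PROVED here (kernel): (§1) `P` monic of degree `4`, irreducible over `ℚ` (Eisenstein at `(13) ⊂ ℤ` + Gauss); every complex root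
`ρ` has `ρ² = (−13 ± √117)/2 ∈ ℝ`, `ρ̄ ≠ ρ` (`r⁴ + 13r² + 13 > 0`), `ρ̄ = −ρ` (`Q = −T`); `Φ₁₃ = 1 + T + ⋯ + T¹²`; the division identity;
`P(φ) = 0` in `End B`. (§2) the R3 body on this locus over `(X₁ ⊗ X₂) ⊗ X₃`, `Xᵢ = X^{2n}₁₃`, from the two refereed named facts; from
the rung — an HONEST SPECIALISATION at `(A, φ, P, e, m) := (B, φ, T⁴ + 13T² + 13, 4, 3n)`, all eight hypotheses discharged —; ON-PATH.

What is NOT in the kernel: the datum (PROPOSITION CYC′, pen-and-paper; `b_𝐒` over ordered TRIPLES of disjoint `h`-subsets of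
`{1,…,6h}`) and `K′`-Weil-ness (THEOREM W′). Census (report §3.3/§7): no non-`E`-Weil family at `N = 4`; at `N = 6` (`n = 2`, abelian
`24`-folds, classes in `H¹²`) the `K′`-Weil NON-`E`-Weil families are `β = (1,1,2,4,8,10)` and `(1,1,4,4,5,11)` (both MOVING).

HONEST LABEL: three-parameter sub-families, never the general member; 0 unconditional rungs above the floor; conditional on
[Shioda 1979 Thm. 2] + [Fulton 1998 Cor. 19.2 (b)] (refereed) and on the datum; Markman-free; the standing `weilClassesField = W_{K′} ⊗ ℂ`
identification flag applies. No `sorry`, no new definition, no new named fact.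
-/

noncomputable section

-- every declaration of this problem lives in `Summit.HodgeConjecture.HodgeConjecture.…` (summit = sub-problem)
set_option linter.dupNamespace false

open CategoryTheory MonoidalCategory Polynomial
open Literature.AlgebraicGeometry Literature.AlgebraicGeometry.Motives
open Literature.AlgebraicGeometry.HodgeTheory
open Literature.AlgebraicTopology.SingularHomology

namespace Summit.HodgeConjecture.HodgeConjecture.WeilTypeLadder

/-! ### §1 The quartic `T⁴ + 13T² + 13` and `Φ₁₃` -/

section Quartic

/-- `T⁴ + 13T² + 13 ∈ ℤ[T]` is monic. [folklore] -/
theorem quarticThirteen_monic : (X ^ 4 + 13 * X ^ 2 + 13 : Polynomial ℤ).Monic := by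
  monicity!

/-- `T⁴ + 13T² + 13` has degree `4`. [folklore] -/
theorem quarticThirteen_natDegree : (X ^ 4 + 13 * X ^ 2 + 13 : Polynomial ℤ).natDegree = 4 := by
  compute_degree!

/-- The coefficients of `T⁴ + 13T² + 13` below the top one are divisible by `13`. [folklore] -/
theorem quarticThirteen_coeff_mem {n : ℕ} (hn : n < 4) :
    (X ^ 4 + 13 * X ^ 2 + 13 : Polynomial ℤ).coeff n ∈ Ideal.span {(13 : ℤ)} := by
  rw [Ideal.mem_span_singleton]
  interval_cases n <;> simp [coeff_X_pow, coeff_ofNat_mul]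

/-- `T⁴ + 13T² + 13` is Eisenstein at `(13)`. [folklore] -/
theorem quarticThirteen_isEisensteinAt :
    (X ^ 4 + 13 * X ^ 2 + 13 : Polynomial ℤ).IsEisensteinAt (Ideal.span {(13 : ℤ)}) where
  leading := by
    rw [Polynomial.Monic.leadingCoeff quarticThirteen_monic, Ideal.mem_span_singleton]; norm_num
  mem := fun {n} hn => quarticThirteen_coeff_mem (by rwa [quarticThirteen_natDegree] at hn)
  notMem := by
    rw [Ideal.span_singleton_pow, Ideal.mem_span_singleton]
    simp [coeff_X_pow, coeff_ofNat_mul]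

/-- `T⁴ + 13T² + 13` is irreducible over `ℚ` (Eisenstein at `13` over `ℤ`, then Gauss's lemma). [folklore] -/
theorem quarticThirteen_irreducible :
    Irreducible ((X ^ 4 + 13 * X ^ 2 + 13 : Polynomial ℤ).map (Int.castRingHom ℚ)) := by
  have hprime : (Ideal.span {(13 : ℤ)}).IsPrime :=
    (Ideal.span_singleton_prime (by norm_num)).mpr (Nat.prime_iff_prime_int.mp (by norm_num))
  have hZ : Irreducible (X ^ 4 + 13 * X ^ 2 + 13 : Polynomial ℤ) :=
    quarticThirteen_isEisensteinAt.irreducible hprime quarticThirteen_monic.isPrimitive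
      (by rw [quarticThirteen_natDegree]; norm_num)
  have := (Polynomial.IsPrimitive.irreducible_iff_irreducible_map_fraction_map (K := ℚ)
    quarticThirteen_monic.isPrimitive).1 hZ
  rwa [← algebraMap_int_eq]

/-- Evaluation of `T⁴ + 13T² + 13` in any ring. -/
theorem eval₂_quarticThirteen {R : Type*} [Ring R] (x : R) :
    Polynomial.eval₂ (Int.castRingHom R) x (X ^ 4 + 13 * X ^ 2 + 13 : Polynomial ℤ) = x ^ 4 + 13 * x ^ 2 + 13 := by
  rw [← algebraMap_int_eq, ← Polynomial.aeval_def]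
  simp only [map_add, map_mul, map_pow, Polynomial.aeval_X, map_ofNat]

/-- A complex root `ρ` of `T⁴ + 13T² + 13` has `ρ² = (−13 ± √117)/2`, a REAL number; in particular `ρ̄² = ρ²`. [folklore] -/
theorem conj_sq_eq_sq_of_quarticThirteen {ρ : ℂ} (hρ : ρ ^ 4 + 13 * ρ ^ 2 + 13 = 0) :
    starRingEnd ℂ (ρ ^ 2) = ρ ^ 2 := by
  have h2 : (2 * ρ ^ 2 + 13) ^ 2 = ((Real.sqrt 117 : ℝ) : ℂ) ^ 2 := by
    have hs : ((Real.sqrt 117 : ℝ) : ℂ) ^ 2 = 117 := by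
      rw [← Complex.ofReal_pow, Real.sq_sqrt (by norm_num : (0 : ℝ) ≤ 117)]; norm_num
    rw [hs]; linear_combination 4 * hρ
  rcases sq_eq_sq_iff_eq_or_eq_neg.1 h2 with h | h
  · have : ρ ^ 2 = (((Real.sqrt 117 - 13) / 2 : ℝ) : ℂ) := by push_cast; linear_combination h / 2
    rw [this, Complex.conj_ofReal]
  · have : ρ ^ 2 = (((-Real.sqrt 117 - 13) / 2 : ℝ) : ℂ) := by push_cast; linear_combination h / 2
    rw [this, Complex.conj_ofReal]

/-- The complex roots of `T⁴ + 13T² + 13` are NON-REAL: the rung's "no real root". [folklore] -/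
theorem conj_ne_self_of_quarticThirteen {ρ : ℂ}
    (hρ : Polynomial.eval₂ (Int.castRingHom ℂ) ρ (X ^ 4 + 13 * X ^ 2 + 13 : Polynomial ℤ) = 0) :
    starRingEnd ℂ ρ ≠ ρ := by
  rw [eval₂_quarticThirteen] at hρ
  intro hc
  have hre : ((ρ.re : ℝ) : ℂ) = ρ := Complex.conj_eq_iff_re.mp hc
  have hr : ((ρ.re ^ 4 + 13 * ρ.re ^ 2 + 13 : ℝ) : ℂ) = 0 := by push_cast; rw [hre]; exact hρ
  have hr' : ρ.re ^ 4 + 13 * ρ.re ^ 2 + 13 = 0 := by exact_mod_cast hr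
  nlinarith [sq_nonneg ρ.re, sq_nonneg (ρ.re ^ 2)]

/-- `Q = −T` carries every complex root of `T⁴ + 13T² + 13` to its conjugate: the rung's "CM involution is a polynomial". [folklore] -/
theorem exists_conjPolynomial_quarticThirteen :
    ∃ Q : Polynomial ℚ, ∀ ρ : ℂ, Polynomial.eval₂ (Int.castRingHom ℂ) ρ (X ^ 4 + 13 * X ^ 2 + 13 : Polynomial ℤ) = 0 →
      Polynomial.eval₂ (algebraMap ℚ ℂ) ρ Q = starRingEnd ℂ ρ := by
  refine ⟨-Polynomial.X, fun ρ hρ => ?_⟩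
  have hne := conj_ne_self_of_quarticThirteen hρ
  rw [eval₂_quarticThirteen] at hρ
  rw [Polynomial.eval₂_neg, Polynomial.eval₂_X]
  have hsq : (starRingEnd ℂ ρ) ^ 2 = ρ ^ 2 := by
    rw [← map_pow]; exact conj_sq_eq_sq_of_quarticThirteen hρ
  rcases sq_eq_sq_iff_eq_or_eq_neg.1 hsq with h | h
  · exact absurd h hne
  · exact h.symm

/-- `Φ₁₃ = 1 + T + ⋯ + T¹²` in `ℤ[T]`. [folklore] -/
theorem cyclotomic_thirteen_eq : Polynomial.cyclotomic 13 ℤ =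
    1 + X + X ^ 2 + X ^ 3 + X ^ 4 + X ^ 5 + X ^ 6 + X ^ 7 + X ^ 8 + X ^ 9 + X ^ 10 + X ^ 11 + X ^ 12 := by
  haveI : Fact (Nat.Prime 13) := ⟨by norm_num⟩
  rw [Polynomial.cyclotomic_prime]
  simp only [Finset.sum_range_succ, Finset.sum_range_zero, zero_add, pow_zero, pow_one]

/-- The division identity `P(φ(T)) = Φ₁₃(T)·q(T)` in `ℤ[T]` for `P = T⁴ + 13T² + 13`, `φ(T) = T + T³ + T⁹ − T⁴ − T¹⁰ − T¹²`
(quotient by integer long division, remainder `0`). [folklore] -/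
theorem quarticThirteen_comp_eq :
    ((X + X ^ 3 + X ^ 9 - X ^ 4 - X ^ 10 - X ^ 12) ^ 4 + 13 * (X + X ^ 3 + X ^ 9 - X ^ 4 - X ^ 10 - X ^ 12) ^ 2 + 13 :
        Polynomial ℤ) =
      (1 + X + X ^ 2 + X ^ 3 + X ^ 4 + X ^ 5 + X ^ 6 + X ^ 7 + X ^ 8 + X ^ 9 + X ^ 10 + X ^ 11 + X ^ 12) *
        (13 - 13 * X + 13 * X ^ 2 - 13 * X ^ 3 + 27 * X ^ 4 - 53 * X ^ 5 + 43 * X ^ 6 - 47 * X ^ 7 + 49 * X ^ 8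
          - 31 * X ^ 9 + 48 * X ^ 10 - 74 * X ^ 11 + 81 * X ^ 12 - 120 * X ^ 13 + 121 * X ^ 14 - 89 * X ^ 15
          + 96 * X ^ 16 - 72 * X ^ 17 + 60 * X ^ 18 - 88 * X ^ 19 + 86 * X ^ 20 - 88 * X ^ 21 + 99 * X ^ 22
          - 72 * X ^ 23 + 57 * X ^ 24 - 50 * X ^ 25 + 30 * X ^ 26 - 29 * X ^ 27 + 29 * X ^ 28 - 22 * X ^ 29
          + 22 * X ^ 30 - 18 * X ^ 31 + 10 * X ^ 32 - 8 * X ^ 33 + 4 * X ^ 34 - X ^ 35 + X ^ 36) := by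
  ring

/-- `Φ₁₃(s) = 0 ⟹ P(s + s³ + s⁹ − s⁴ − s¹⁰ − s¹²) = 0` in any ring, `P = T⁴ + 13T² + 13`. [folklore] -/
theorem eval₂_quarticThirteen_periodDiff {R : Type*} [Ring R] (s : R)
    (hs : Polynomial.eval₂ (Int.castRingHom R) s (Polynomial.cyclotomic 13 ℤ) = 0) :
    Polynomial.eval₂ (Int.castRingHom R) (s + s ^ 3 + s ^ 9 - s ^ 4 - s ^ 10 - s ^ 12)
      (X ^ 4 + 13 * X ^ 2 + 13 : Polynomial ℤ) = 0 := by
  rw [cyclotomic_thirteen_eq, ← algebraMap_int_eq, ← Polynomial.aeval_def] at hs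
  rw [← algebraMap_int_eq, ← Polynomial.aeval_def]
  have h1 : Polynomial.aeval (s + s ^ 3 + s ^ 9 - s ^ 4 - s ^ 10 - s ^ 12) (X ^ 4 + 13 * X ^ 2 + 13 : Polynomial ℤ) =
      Polynomial.aeval s (((X + X ^ 3 + X ^ 9 - X ^ 4 - X ^ 10 - X ^ 12) ^ 4 +
        13 * (X + X ^ 3 + X ^ 9 - X ^ 4 - X ^ 10 - X ^ 12) ^ 2 + 13 : Polynomial ℤ)) := by
    simp only [map_add, map_sub, map_mul, map_pow, Polynomial.aeval_X, map_ofNat]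
  rw [h1, quarticThirteen_comp_eq, map_mul, hs, zero_mul]

end Quartic

/-! ### §2 R3 for `K′ = ℚ(ζ₁₃)^{C₃} = ℚ(φ)` on the `ζ₁₃`-primitive loci over the Fermat triple `(Xʰ₁₃ ⊗ Xʰ₁₃) ⊗ Xʰ₁₃` -/

section ThirteenQuartic

/-- **R3 for the quartic `K′ = ℚ(ζ₁₃)^{C₃}` on the Fermat-triple-dominated `ζ₁₃`-locus, from the two named facts.** For an abelian
variety `B` with `s : B ⟶ B`, `Φ₁₃(s) = 0`, `dim B = 12n` (`h = 2n`), and a datum (`X₁, X₂, X₃` smooth projective Fermat varieties `X^{2n}₁₃`,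
`T` smooth projective of dimension `dim B`, `a : T ⟶ B` surjective, `b : ι → (T ⟶ (X₁ ⊗ X₂) ⊗ X₃)`), every class of
`weilClassesField B φ (T⁴ + 13T² + 13) (6n) = W_{K′} ⊗ ℂ` (`φ = s + s³ + s⁹ − s⁴ − s¹⁰ − s¹²`) whose pull-back lies in
`⨆ᵢ (bᵢ)^*(span of the rational (3n,3n)-classes of (X₁ ⊗ X₂) ⊗ X₃)` and which is rational of type `(3n,3n)` is algebraic. At `n = 2`: the
families `(1,1,2,4,8,10)`, `(1,1,4,4,5,11)` of abelian `24`-folds (report §3.3).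
[cite: Shioda1979PJA, §2 Thm. 2 (p. 112) with the list after Thm. 1] [cite: Fulton1998, §19.2 Cor. 19.2 (b)] [cite: MoonenZarhin1998WeilClasses, §1] -/
theorem weilClassesCMField_cyclicPrymThirteen_quartic_of_facts
    (hF₃ : hodgeClasses_algebraic_fermatProduct₃) (hP : fulton1998_map_mem_algebraicClasses) :
    ∀ (B : Motives.AbelianVariety ℂ) (s : B ⟶ B) (n : ℕ),
      Polynomial.eval₂ (Int.castRingHom (CategoryTheory.End B)) (s : CategoryTheory.End B)
        (Polynomial.cyclotomic 13 ℤ) = 0 → B.dim = 12 * n →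
    ∀ (X₁ X₂ X₃ T : Motives.SchemeOver ℂ),
      IsFermatVariety (2 * n) 13 X₁ → IsSmoothProjective (2 * n) X₁ → IsFermatVariety (2 * n) 13 X₂ →
      IsSmoothProjective (2 * n) X₂ → IsFermatVariety (2 * n) 13 X₃ → IsSmoothProjective (2 * n) X₃ →
      IsSmoothProjective B.dim T →
    ∀ (a : T ⟶ B.X), AlgebraicGeometry.Surjective a.left → ∀ (ι : Type) (b : ι → (T ⟶ (X₁ ⊗ X₂) ⊗ X₃)),
      ∀ c ∈ weilClassesField B
          (CategoryTheory.End.asHom (CategoryTheory.End.of s + CategoryTheory.End.of s ^ 3 + CategoryTheory.End.of s ^ 9 -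
            CategoryTheory.End.of s ^ 4 - CategoryTheory.End.of s ^ 10 - CategoryTheory.End.of s ^ 12))
          (X ^ 4 + 13 * X ^ 2 + 13 : Polynomial ℤ) (2 * (3 * n)),
        complexBetti.map a (2 * (3 * n)) c ∈ (⨆ i, (Submodule.span ℂ
            {x : complexBetti ((X₁ ⊗ X₂) ⊗ X₃) (2 * (3 * n)) |
              IsRationalClass x ∧ IsOfHodgeType (2 * n + 2 * n + 2 * n) ((X₁ ⊗ X₂) ⊗ X₃) (2 * (3 * n)) (3 * n) (3 * n) x}).map
              (complexBetti.map (b i) (2 * (3 * n))).hom) →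
        IsRationalClass c → IsOfHodgeType B.dim B.X (2 * (3 * n)) (3 * n) (3 * n) c → c ∈ algebraicClasses B.X (3 * n) := by
  intro B s n _ _ X₁ X₂ X₃ T hF₁' hX₁ hF₂' hX₂ hF₃' hX₃ hT a ha ι b c _ hc _ _
  exact abelianVariety_mem_algebraicClasses_of_targetTransferFamily hP B ((hX₁.tensor_holds hX₂).tensor_holds hX₃)
    (span_rational_hodge_le_algebraicClasses_fermatProduct₃ hF₃ (Or.inl (by norm_num)) hF₁' hX₁ hF₂' hX₂ hF₃' hX₃ (3 * n))
    hT a b hc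

/-- **The same body from the rung R3 itself** — an HONEST SPECIALISATION at `(A, φ, P, e, m) := (B, φ, T⁴ + 13T² + 13, 4, 3n)`:
`P` monic irreducible of degree `4 > 2` (Eisenstein at `13`), `P(φ) = 0` from `Φ₁₃(s) = 0`, `4·(2·3n) = 2·dim B`, roots non-real,
`Q = −T` — every arithmetic hypothesis DISCHARGED; the datum is not used. -/
theorem weilClassesCMField_cyclicPrymThirteen_quartic_of_weilClassesCMField (hR : WeilClassesCMField) :
    ∀ (B : Motives.AbelianVariety ℂ) (s : B ⟶ B) (n : ℕ),
      Polynomial.eval₂ (Int.castRingHom (CategoryTheory.End B)) (s : CategoryTheory.End B)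
        (Polynomial.cyclotomic 13 ℤ) = 0 → B.dim = 12 * n →
    ∀ (X₁ X₂ X₃ T : Motives.SchemeOver ℂ),
      IsFermatVariety (2 * n) 13 X₁ → IsSmoothProjective (2 * n) X₁ → IsFermatVariety (2 * n) 13 X₂ →
      IsSmoothProjective (2 * n) X₂ → IsFermatVariety (2 * n) 13 X₃ → IsSmoothProjective (2 * n) X₃ →
      IsSmoothProjective B.dim T →
    ∀ (a : T ⟶ B.X), AlgebraicGeometry.Surjective a.left → ∀ (ι : Type) (b : ι → (T ⟶ (X₁ ⊗ X₂) ⊗ X₃)),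
      ∀ c ∈ weilClassesField B
          (CategoryTheory.End.asHom (CategoryTheory.End.of s + CategoryTheory.End.of s ^ 3 + CategoryTheory.End.of s ^ 9 -
            CategoryTheory.End.of s ^ 4 - CategoryTheory.End.of s ^ 10 - CategoryTheory.End.of s ^ 12))
          (X ^ 4 + 13 * X ^ 2 + 13 : Polynomial ℤ) (2 * (3 * n)),
        complexBetti.map a (2 * (3 * n)) c ∈ (⨆ i, (Submodule.span ℂ
            {x : complexBetti ((X₁ ⊗ X₂) ⊗ X₃) (2 * (3 * n)) |
              IsRationalClass x ∧ IsOfHodgeType (2 * n + 2 * n + 2 * n) ((X₁ ⊗ X₂) ⊗ X₃) (2 * (3 * n)) (3 * n) (3 * n) x}).map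
              (complexBetti.map (b i) (2 * (3 * n))).hom) →
        IsRationalClass c → IsOfHodgeType B.dim B.X (2 * (3 * n)) (3 * n) (3 * n) c → c ∈ algebraicClasses B.X (3 * n) := by
  intro B s n hs hdim _ _ _ _ _ _ _ _ _ _ _ _ _ _ _ c hcW _ hc hmm
  have hφ : Polynomial.eval₂ (Int.castRingHom (CategoryTheory.End B))
      ((CategoryTheory.End.asHom (CategoryTheory.End.of s + CategoryTheory.End.of s ^ 3 + CategoryTheory.End.of s ^ 9 -
        CategoryTheory.End.of s ^ 4 - CategoryTheory.End.of s ^ 10 - CategoryTheory.End.of s ^ 12) : B ⟶ B) :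
        CategoryTheory.End B) (X ^ 4 + 13 * X ^ 2 + 13 : Polynomial ℤ) = 0 :=
    eval₂_quarticThirteen_periodDiff (CategoryTheory.End.of s) hs
  exact hR B _ (X ^ 4 + 13 * X ^ 2 + 13 : Polynomial ℤ) 4 (3 * n) quarticThirteen_monic
    quarticThirteen_natDegree (by norm_num) quarticThirteen_irreducible hφ (by omega)
    (fun ρ hρ => conj_ne_self_of_quarticThirteen hρ) exists_conjPolynomial_quarticThirteen c hcW hc hmm

/-- **On-path lemma**: `HodgeConjecture → WeilClassesCMField →` R3 for `ℚ(ζ₁₃)^{C₃}` on the `ζ₁₃`-locus. -/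
theorem weilClassesCMField_cyclicPrymThirteen_quartic_of_hodgeConjecture (hH : _root_.HodgeConjecture) :
    ∀ (B : Motives.AbelianVariety ℂ) (s : B ⟶ B) (n : ℕ),
      Polynomial.eval₂ (Int.castRingHom (CategoryTheory.End B)) (s : CategoryTheory.End B)
        (Polynomial.cyclotomic 13 ℤ) = 0 → B.dim = 12 * n →
    ∀ (X₁ X₂ X₃ T : Motives.SchemeOver ℂ),
      IsFermatVariety (2 * n) 13 X₁ → IsSmoothProjective (2 * n) X₁ → IsFermatVariety (2 * n) 13 X₂ →
      IsSmoothProjective (2 * n) X₂ → IsFermatVariety (2 * n) 13 X₃ → IsSmoothProjective (2 * n) X₃ →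
      IsSmoothProjective B.dim T →
    ∀ (a : T ⟶ B.X), AlgebraicGeometry.Surjective a.left → ∀ (ι : Type) (b : ι → (T ⟶ (X₁ ⊗ X₂) ⊗ X₃)),
      ∀ c ∈ weilClassesField B
          (CategoryTheory.End.asHom (CategoryTheory.End.of s + CategoryTheory.End.of s ^ 3 + CategoryTheory.End.of s ^ 9 -
            CategoryTheory.End.of s ^ 4 - CategoryTheory.End.of s ^ 10 - CategoryTheory.End.of s ^ 12))
          (X ^ 4 + 13 * X ^ 2 + 13 : Polynomial ℤ) (2 * (3 * n)),
        complexBetti.map a (2 * (3 * n)) c ∈ (⨆ i, (Submodule.span ℂ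
            {x : complexBetti ((X₁ ⊗ X₂) ⊗ X₃) (2 * (3 * n)) |
              IsRationalClass x ∧ IsOfHodgeType (2 * n + 2 * n + 2 * n) ((X₁ ⊗ X₂) ⊗ X₃) (2 * (3 * n)) (3 * n) (3 * n) x}).map
              (complexBetti.map (b i) (2 * (3 * n))).hom) →
        IsRationalClass c → IsOfHodgeType B.dim B.X (2 * (3 * n)) (3 * n) (3 * n) c → c ∈ algebraicClasses B.X (3 * n) :=
  weilClassesCMField_cyclicPrymThirteen_quartic_of_weilClassesCMField (weilClassesCMField_of_hodgeConjecture hH)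

end ThirteenQuartic

end Summit.HodgeConjecture.HodgeConjecture.WeilTypeLadder

end
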